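import Literature.Topology.FourManifolds.TrisectionsTubeSaturationModel
import Mathlib.Analysis.SpecialFunctions.Sqrt
import HarnessLib

/-!
# The belt modification of the handlebody's Morse function: critical points and index on the
# level near the belt circle of a `2`-handle (model computation)

Topic `Literature/Topology/FourManifolds`; model-space calculus for the fact seat
`provefact-Literature.Topology.FourManifolds.exists_isBalancedGKTrisection` (Gay–Kirby 2016,
Thm. 4 via §4, Lemma 14).  Everything in this file is **proved**; the definitions are explicit
functions on `ℝ⁴`.

In Milnor's coordinates `u = (x⃗, y⃗) ∈ ℝ² × ℝ²` of a `2`-handle (`f = f(c) - A + B`,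
`A = |x⃗|²`, `B = |y⃗|²`), the lid of the handlebody `H₂₃ = X₂ ∩ X₃` of the trisection
construction is the level `{B - A = ν²}` of `f` just above the critical point, and it contains
the **belt circle** `{x⃗ = 0, |y⃗| = ν}`, across which the Heegaard function lifted along the
trajectories (`c₀ 𝒯`, `𝒯 = 1 - ε x₀²/A + (κ/η) A B` Gay–Kirby's tube function) does not extend.
The Morse function of `H₂₃` is therefore modified near the belt circle into

  `G(u) = K k₁ · A B - K ε · ρ(A) x₀² - τ · χ₂(A) · y₀ / |y⃗|`

(`ρ(A) = 1/A` away from the core, `ρ = 0` near `A = 0`; `χ₂ = 1` near `A = 0`, `χ₂ = 0` away;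
the last term is a small multiple of `cos θ_y`, breaking the rotational symmetry of the belt
circle).  This file proves, by explicit differentiation:

* `BeltModel.hasFDerivAt_belt`, `BeltModel.fderiv_belt_apply` — the derivative of `G` off
  `{y⃗ = 0}`;
* `BeltModel.critical_iff` — **on the level `{B - A = ν²}`, `DG` vanishes on the tangent
  hyperplane `ker D(B - A)` exactly at the two points `(0, 0, ±ν, 0)`** (Lagrange's condition
  tested on the rotation of `x⃗`, the rotation of `y⃗`, and the level-tangent radial vector
  `(x⃗, (A/B) y⃗)`, under the smallness `K ε L + τ L₂ < K k₁ ν²` of the angular amplitude `ε`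
  and of `τ` against the radial growth — `L`, `L₂` bounding `(Aρ)'` and `χ₂'`), and
  `BeltModel.fderiv_belt_eq_zero` — these two points are critical points of `G` on `ℝ⁴`;
* `BeltModel.fderiv_fderiv_belt_apply` — **the Hessian of `G` at `(0, 0, ±ν, 0)` is
  `2 K k₁ ν² (v₀w₀ + v₁w₁) ± (τ/ν²) v₃w₃`**;
* `BeltModel.nondegenerate_and_sigNeg_eq_zero_of_apply_eq`,
  `BeltModel.nondegenerate_and_sigNeg_eq_one_of_apply_eq` — restricted to the tangent
  hyperplane `{v₂ = 0}` of the level this form is nondegenerate, of negative index of inertia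
  `0` at `(0, 0, ν, 0)` and `1` at `(0, 0, -ν, 0)`.

With the dictionary of `BoundarySliceMorseLevel.lean` this certifies: the modified Morse
function of `H₂₃` has near each belt circle exactly two critical points, nondegenerate, of
indices `0` and `1` — one cancelling pair per `2`-handle, which leaves the genus of `H₂₃`
equal to that of `H₁₂` (Gay–Kirby, proof of Lemma 14: "`F × I ∪ (2-handles)` is a genus-`g`
handlebody").

## References

* D. Gay, R. Kirby, *Trisecting 4-manifolds*, Geom. Topol. 20 (2016), §4, Lemma 14. [GayKirby2016]
* J. Milnor, *Morse theory* (1963), §2 (nondegenerate critical points, index; Sylvester). [Milnor1963]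
* J. Milnor, *Lectures on the h-cobordism theorem* (1965), Def. 3.1 (Milnor's coordinates). [MilnorHCobordism1965]
-/

open scoped ContDiff Topology
open Set Function Filter

noncomputable section

namespace Literature.Topology.FourManifolds

namespace BeltModel

/-- Local notation: `𝔼 n` is the model Euclidean space `EuclideanSpace ℝ (Fin n)`. -/
local notation "𝔼 " n:arg => EuclideanSpace ℝ (Fin n)

/-! ### Coordinates -/

/-- `A = |x⃗|² = u₀² + u₁²`: the tree's `TubeModel.nsq ∘ RadialThickening.proj` (an abbreviation,
so that the vocabulary of `TrisectionsTubeModel.lean` is reused). [cite: MilnorHCobordism1965, Def. 3.1] -/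
abbrev qA (u : 𝔼 4) : ℝ := TubeModel.nsq (RadialThickening.proj u)

/-- `B = |y⃗|² = u₂² + u₃²`: the tree's `RadialThickening.bsq` (an abbreviation). [cite: MilnorHCobordism1965, Def. 3.1] -/
abbrev qB (u : 𝔼 4) : ℝ := RadialThickening.bsq u

/-- `⟨x⃗(u), x⃗(v)⟩ = u₀v₀ + u₁v₁`. [folklore] -/
def xdot (u v : 𝔼 4) : ℝ := u 0 * v 0 + u 1 * v 1

/-- `⟨y⃗(u), y⃗(v)⟩ = u₂v₂ + u₃v₃`. [folklore] -/
def ydot (u v : 𝔼 4) : ℝ := u 2 * v 2 + u 3 * v 3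

/-- Unfolding. [folklore] -/ theorem qA_apply (u : 𝔼 4) : qA u = u 0 ^ 2 + u 1 ^ 2 := rfl
/-- Unfolding. [folklore] -/ theorem qB_apply (u : 𝔼 4) : qB u = u 2 ^ 2 + u 3 ^ 2 := rfl
/-- Unfolding. [folklore] -/ theorem xdot_apply (u v : 𝔼 4) : xdot u v = u 0 * v 0 + u 1 * v 1 := rfl
/-- Unfolding. [folklore] -/ theorem ydot_apply (u v : 𝔼 4) : ydot u v = u 2 * v 2 + u 3 * v 3 := rfl

/-- `A ≥ 0`. [folklore] -/ theorem qA_nonneg (u : 𝔼 4) : 0 ≤ qA u := by rw [qA_apply]; positivity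
/-- `B ≥ 0`. [folklore] -/ theorem qB_nonneg (u : 𝔼 4) : 0 ≤ qB u := by rw [qB_apply]; positivity

/-- `A = 0` iff `x⃗ = 0`. [folklore] -/
theorem qA_eq_zero_iff (u : 𝔼 4) : qA u = 0 ↔ u 0 = 0 ∧ u 1 = 0 := by
  rw [qA_apply]
  constructor
  · intro h
    have h0 : u 0 ^ 2 = 0 := by nlinarith [sq_nonneg (u 0), sq_nonneg (u 1)]
    have h1 : u 1 ^ 2 = 0 := by nlinarith [sq_nonneg (u 0), sq_nonneg (u 1)]
    exact ⟨pow_eq_zero_iff (n := 2) (by norm_num) |>.1 h0, pow_eq_zero_iff (n := 2) (by norm_num) |>.1 h1⟩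
  · rintro ⟨h0, h1⟩; rw [h0, h1]; ring

/-- The coordinate functional `u ↦ uᵢ` on `ℝ⁴`. [folklore] -/
abbrev P (i : Fin 4) : 𝔼 4 →L[ℝ] ℝ := EuclideanSpace.proj i

/-- `P i u = u i`. [folklore] -/
@[simp] theorem P_apply (i : Fin 4) (u : 𝔼 4) : P i u = u i := rfl

/-- Derivative of a coordinate. [folklore] -/
theorem hasFDerivAt_coord (i : Fin 4) (u : 𝔼 4) : HasFDerivAt (fun u : 𝔼 4 => u i) (P i) u :=
  (P i).hasFDerivAt

/-- **`DA(u) = 2u₀ du₀ + 2u₁ du₁`.** [folklore] -/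
theorem hasFDerivAt_qA (u : 𝔼 4) :
    HasFDerivAt qA ((2 * u 0) • P 0 + (2 * u 1) • P 1) u := by
  have h0 := (hasFDerivAt_coord 0 u).pow 2
  have h1 := (hasFDerivAt_coord 1 u).pow 2
  have h := h0.add h1
  refine (h.congr_fderiv ?_).congr_of_eventuallyEq (Eventually.of_forall fun v => rfl)
  ext v
  simp only [add_apply, FunLike.coe_smul, Pi.smul_apply, P_apply, smul_eq_mul]
  ring

/-- **`DB(u) = 2u₂ du₂ + 2u₃ du₃`.** [folklore] -/
theorem hasFDerivAt_qB (u : 𝔼 4) :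
    HasFDerivAt qB ((2 * u 2) • P 2 + (2 * u 3) • P 3) u := by
  have h2 := (hasFDerivAt_coord 2 u).pow 2
  have h3 := (hasFDerivAt_coord 3 u).pow 2
  have h := h2.add h3
  refine (h.congr_fderiv ?_).congr_of_eventuallyEq (Eventually.of_forall fun v => rfl)
  ext v
  simp only [add_apply, FunLike.coe_smul, Pi.smul_apply, P_apply, smul_eq_mul]
  ring

/-- `DA(u) v = 2⟨x⃗(u), x⃗(v)⟩`. [folklore] -/
theorem fderiv_qA_apply (u v : 𝔼 4) : fderiv ℝ qA u v = 2 * xdot u v := by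
  rw [(hasFDerivAt_qA u).fderiv]
  simp only [add_apply, FunLike.coe_smul, Pi.smul_apply, P_apply, smul_eq_mul, xdot_apply]
  ring

/-- `DB(u) v = 2⟨y⃗(u), y⃗(v)⟩`. [folklore] -/
theorem fderiv_qB_apply (u v : 𝔼 4) : fderiv ℝ qB u v = 2 * ydot u v := by
  rw [(hasFDerivAt_qB u).fderiv]
  simp only [add_apply, FunLike.coe_smul, Pi.smul_apply, P_apply, smul_eq_mul, ydot_apply]
  ring

/-- `A` and `B` are smooth. [folklore] -/
theorem contDiff_qA : ContDiff ℝ ∞ qA :=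
  ((contDiff_piLp_apply (p := 2) (i := (0 : Fin 4))).pow 2).add ((contDiff_piLp_apply (p := 2) (i := (1 : Fin 4))).pow 2)

/-- `B` is smooth. [folklore] -/
theorem contDiff_qB : ContDiff ℝ ∞ qB :=
  ((contDiff_piLp_apply (p := 2) (i := (2 : Fin 4))).pow 2).add ((contDiff_piLp_apply (p := 2) (i := (3 : Fin 4))).pow 2)

/-! ### The belt function and its derivative -/

/-- **The belt function** `G(u) = K k₁ A B - K ε ρ(A) u₀² - τ χ₂(A) u₂ / √B` (the modified lifted
Heegaard function near a belt circle, up to an additive constant, read in Milnor's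
coordinates). [cite: GayKirby2016, §4, Lemma 14] -/
def belt (K ε k₁ τ : ℝ) (ρ χ₂ : ℝ → ℝ) (u : 𝔼 4) : ℝ :=
  K * k₁ * (qA u * qB u) - K * ε * (ρ (qA u) * u 0 ^ 2) - τ * (χ₂ (qA u) * u 2 * (Real.sqrt (qB u))⁻¹)

/-- **The derivative of the belt function applied to `v`** (explicit formula; `ρ'`, `χ₂'` the
derivatives of the profiles). [folklore] -/
def dbelt (K ε k₁ τ : ℝ) (ρ χ₂ : ℝ → ℝ) (u v : 𝔼 4) : ℝ :=
  K * k₁ * (2 * xdot u v * qB u + qA u * (2 * ydot u v))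
  - K * ε * (deriv ρ (qA u) * (2 * xdot u v) * u 0 ^ 2 + ρ (qA u) * (2 * u 0 * v 0))
  - τ * (deriv χ₂ (qA u) * (2 * xdot u v) * u 2 * (Real.sqrt (qB u))⁻¹
      + χ₂ (qA u) * (v 2 * (Real.sqrt (qB u))⁻¹
        + u 2 * (-((Real.sqrt (qB u))⁻¹ ^ 3) * ydot u v)))

variable {K ε k₁ τ : ℝ} {ρ χ₂ : ℝ → ℝ}

/-- The derivative of `u ↦ (√(B u))⁻¹` off `{y⃗ = 0}`: `v ↦ -(√B)⁻³ ⟨y⃗(u), y⃗(v)⟩`. [folklore] -/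
theorem hasFDerivAt_sqrt_qB_inv {u : 𝔼 4} (hB : qB u ≠ 0) :
    HasFDerivAt (fun u => (Real.sqrt (qB u))⁻¹)
      ((-((Real.sqrt (qB u))⁻¹ ^ 3)) • ((2⁻¹ : ℝ) • ((2 * u 2) • P 2 + (2 * u 3) • P 3))) u := by
  have hBpos : 0 < qB u := lt_of_le_of_ne (qB_nonneg u) (Ne.symm hB)
  have hs : Real.sqrt (qB u) ≠ 0 := Real.sqrt_ne_zero'.2 hBpos
  have h1 : HasDerivAt (fun t => (Real.sqrt t)⁻¹) (-(1 / (2 * Real.sqrt (qB u))) / Real.sqrt (qB u) ^ 2) (qB u) :=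
    (Real.hasDerivAt_sqrt hB).inv hs
  have h2 := h1.comp_hasFDerivAt u (hasFDerivAt_qB u)
  refine h2.congr_fderiv ?_
  ext v
  simp only [FunLike.coe_smul, Pi.smul_apply, add_apply, P_apply, smul_eq_mul]
  field_simp

/-- **The derivative of the belt function** off `{y⃗ = 0}`. [folklore] -/
theorem hasFDerivAt_belt (hρ : Differentiable ℝ ρ) (hχ : Differentiable ℝ χ₂) {u : 𝔼 4} (hB : qB u ≠ 0) :
    HasFDerivAt (belt K ε k₁ τ ρ χ₂)
      ((K * k₁) • (qB u • ((2 * u 0) • P 0 + (2 * u 1) • P 1) + qA u • ((2 * u 2) • P 2 + (2 * u 3) • P 3))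
        - (K * ε) • ((u 0 ^ 2) • (deriv ρ (qA u) • ((2 * u 0) • P 0 + (2 * u 1) • P 1))
            + ρ (qA u) • ((2 * u 0) • P 0))
        - τ • ((u 2 * (Real.sqrt (qB u))⁻¹) • (deriv χ₂ (qA u) • ((2 * u 0) • P 0 + (2 * u 1) • P 1))
            + χ₂ (qA u) • ((Real.sqrt (qB u))⁻¹ • P 2
              + (u 2) • ((-((Real.sqrt (qB u))⁻¹ ^ 3)) • ((2⁻¹ : ℝ) • ((2 * u 2) • P 2 + (2 * u 3) • P 3)))))) u := by
  have hA := hasFDerivAt_qA u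
  have hBd := hasFDerivAt_qB u
  -- `K k₁ A B`
  have h1 : HasFDerivAt (fun u => qA u * qB u) (qA u • ((2 * u 2) • P 2 + (2 * u 3) • P 3) +
      qB u • ((2 * u 0) • P 0 + (2 * u 1) • P 1)) u := hA.mul hBd
  -- `ρ(A) u₀²`
  have hρA : HasFDerivAt (fun u => ρ (qA u)) (deriv ρ (qA u) • ((2 * u 0) • P 0 + (2 * u 1) • P 1)) u :=
    (hρ (qA u)).hasDerivAt.comp_hasFDerivAt u hA
  have hsq0 : HasFDerivAt (fun u : 𝔼 4 => u 0 ^ 2) ((2 * u 0) • P 0) u := by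
    have := (hasFDerivAt_coord 0 u).pow 2
    refine this.congr_fderiv ?_
    ext v; simp
  have h2 : HasFDerivAt (fun u => ρ (qA u) * u 0 ^ 2)
      (ρ (qA u) • ((2 * u 0) • P 0) + (u 0 ^ 2) • (deriv ρ (qA u) • ((2 * u 0) • P 0 + (2 * u 1) • P 1))) u :=
    hρA.mul hsq0
  -- `χ₂(A) u₂ (√B)⁻¹`
  have hχA : HasFDerivAt (fun u => χ₂ (qA u)) (deriv χ₂ (qA u) • ((2 * u 0) • P 0 + (2 * u 1) • P 1)) u :=
    (hχ (qA u)).hasDerivAt.comp_hasFDerivAt u hA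
  have hinv := hasFDerivAt_sqrt_qB_inv hB
  have h3a : HasFDerivAt (fun u : 𝔼 4 => u 2 * (Real.sqrt (qB u))⁻¹)
      (u 2 • ((-((Real.sqrt (qB u))⁻¹ ^ 3)) • ((2⁻¹ : ℝ) • ((2 * u 2) • P 2 + (2 * u 3) • P 3))) +
        (Real.sqrt (qB u))⁻¹ • P 2) u := (hasFDerivAt_coord 2 u).mul hinv
  have h3 : HasFDerivAt (fun u => χ₂ (qA u) * (u 2 * (Real.sqrt (qB u))⁻¹))
      (χ₂ (qA u) • (u 2 • ((-((Real.sqrt (qB u))⁻¹ ^ 3)) • ((2⁻¹ : ℝ) • ((2 * u 2) • P 2 + (2 * u 3) • P 3))) +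
        (Real.sqrt (qB u))⁻¹ • P 2) +
        (u 2 * (Real.sqrt (qB u))⁻¹) • (deriv χ₂ (qA u) • ((2 * u 0) • P 0 + (2 * u 1) • P 1))) u :=
    hχA.mul h3a
  have hall := ((h1.const_mul (K * k₁)).sub (h2.const_mul (K * ε))).sub (h3.const_mul τ)
  have hall' : HasFDerivAt (belt K ε k₁ τ ρ χ₂) _ u :=
    hall.congr_of_eventuallyEq (Eventually.of_forall fun y => by
      simp only [belt, Pi.sub_apply]; ring)
  refine hall'.congr_fderiv ?_
  ext v
  simp only [sub_apply, add_apply, FunLike.coe_smul,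
    Pi.smul_apply, P_apply, smul_eq_mul]
  ring

/-- The belt function is differentiable off `{y⃗ = 0}`. [folklore] -/
theorem differentiableAt_belt (hρ : Differentiable ℝ ρ) (hχ : Differentiable ℝ χ₂) {u : 𝔼 4} (hB : qB u ≠ 0) :
    DifferentiableAt ℝ (belt K ε k₁ τ ρ χ₂) u :=
  (hasFDerivAt_belt hρ hχ hB).differentiableAt

/-- **`DG(u) v = dbelt u v`** off `{y⃗ = 0}`. [folklore] -/
theorem fderiv_belt_apply (hρ : Differentiable ℝ ρ) (hχ : Differentiable ℝ χ₂) {u : 𝔼 4} (hB : qB u ≠ 0)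
    (v : 𝔼 4) : fderiv ℝ (belt K ε k₁ τ ρ χ₂) u v = dbelt K ε k₁ τ ρ χ₂ u v := by
  rw [(hasFDerivAt_belt hρ hχ hB).fderiv]
  simp only [sub_apply, add_apply, FunLike.coe_smul,
    Pi.smul_apply, P_apply, smul_eq_mul, dbelt, xdot_apply, ydot_apply]
  ring

/-- The belt function is `C^∞` off `{y⃗ = 0}` for smooth profiles. [folklore] -/
theorem contDiffAt_belt (hρ : ContDiff ℝ ∞ ρ) (hχ : ContDiff ℝ ∞ χ₂) {u : 𝔼 4} (hB : qB u ≠ 0) :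
    ContDiffAt ℝ ∞ (belt K ε k₁ τ ρ χ₂) u := by
  have hBpos : 0 < qB u := lt_of_le_of_ne (qB_nonneg u) (Ne.symm hB)
  have hA : ContDiffAt ℝ ∞ qA u := contDiff_qA.contDiffAt
  have hBs : ContDiffAt ℝ ∞ qB u := contDiff_qB.contDiffAt
  have hsqrt : ContDiffAt ℝ ∞ (fun u => (Real.sqrt (qB u))⁻¹) u := by
    have h1 : ContDiffAt ℝ ∞ (fun u => Real.sqrt (qB u)) u := hBs.sqrt hB
    exact h1.inv (Real.sqrt_ne_zero'.2 hBpos)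
  have hc0 : ContDiffAt ℝ ∞ (fun u : 𝔼 4 => u 0) u := (contDiff_piLp_apply (p := 2) (i := (0 : Fin 4))).contDiffAt
  have hc2 : ContDiffAt ℝ ∞ (fun u : 𝔼 4 => u 2) u := (contDiff_piLp_apply (p := 2) (i := (2 : Fin 4))).contDiffAt
  unfold belt
  exact ((contDiffAt_const.mul (hA.mul hBs)).sub (contDiffAt_const.mul ((hρ.contDiffAt.comp u hA).mul (hc0.pow 2)))).sub
    (contDiffAt_const.mul (((hχ.contDiffAt.comp u hA).mul hc2).mul hsqrt))

/-! ### Lagrange's condition on the level `{B - A = ν²}`: the three test vectors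

The rotation `rotX u = (-u₁, u₀, 0, 0)` of `x⃗` is the tree's `TubeSaturation.rotX`. -/

open TubeSaturation (rotX rotX_apply_zero rotX_apply_one rotX_apply_two rotX_apply_three)

/-- The rotation of `y⃗`: `v₂ = (0, 0, -u₃, u₂)`. [folklore] -/
def rotY (u : 𝔼 4) : 𝔼 4 := WithLp.toLp 2 ![0, 0, -u 3, u 2]

/-- The level-tangent radial vector `v₃ = (x⃗, (A/B) y⃗)`. [folklore] -/
def radV (u : 𝔼 4) : 𝔼 4 := WithLp.toLp 2 ![u 0, u 1, qA u / qB u * u 2, qA u / qB u * u 3]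

/-- Coordinate of a test vector. [folklore] -/
@[simp] theorem rotY_apply0 (u : 𝔼 4) : rotY u 0 = 0 := rfl
/-- Coordinate of a test vector. [folklore] -/
@[simp] theorem rotY_apply1 (u : 𝔼 4) : rotY u 1 = 0 := rfl
/-- Coordinate of a test vector. [folklore] -/
@[simp] theorem rotY_apply2 (u : 𝔼 4) : rotY u 2 = -u 3 := rfl
/-- Coordinate of a test vector. [folklore] -/
@[simp] theorem rotY_apply3 (u : 𝔼 4) : rotY u 3 = u 2 := rfl
/-- Coordinate of a test vector. [folklore] -/
@[simp] theorem radV_apply0 (u : 𝔼 4) : radV u 0 = u 0 := rfl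
/-- Coordinate of a test vector. [folklore] -/
@[simp] theorem radV_apply1 (u : 𝔼 4) : radV u 1 = u 1 := rfl
/-- Coordinate of a test vector. [folklore] -/
@[simp] theorem radV_apply2 (u : 𝔼 4) : radV u 2 = qA u / qB u * u 2 := rfl
/-- Coordinate of a test vector. [folklore] -/
@[simp] theorem radV_apply3 (u : 𝔼 4) : radV u 3 = qA u / qB u * u 3 := rfl

/-- The three test vectors are tangent to the levels of `B - A`:
`D(B - A)(u) v = 2⟨y⃗, v_y⟩ - 2⟨x⃗, v_x⟩ = 0`. [folklore] -/
theorem level_rotX (u : 𝔼 4) : 2 * ydot u (rotX u) - 2 * xdot u (rotX u) = 0 := by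
  simp [xdot_apply, ydot_apply]; ring

/-- `v₂` is level-tangent. [folklore] -/
theorem level_rotY (u : 𝔼 4) : 2 * ydot u (rotY u) - 2 * xdot u (rotY u) = 0 := by
  simp [xdot_apply, ydot_apply]; ring

/-- `v₃` is level-tangent (for `B ≠ 0`). [folklore] -/
theorem level_radV {u : 𝔼 4} (hB : qB u ≠ 0) : 2 * ydot u (radV u) - 2 * xdot u (radV u) = 0 := by
  simp only [xdot_apply, ydot_apply, radV_apply0, radV_apply1, radV_apply2, radV_apply3]
  rw [qA_apply, qB_apply] at *
  field_simp
  ring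

/-- **`DG(u) v₁ = 2 K ε ρ(A) u₀ u₁`** (rotation of `x⃗`). [folklore] -/
theorem dbelt_rotX (u : 𝔼 4) : dbelt K ε k₁ τ ρ χ₂ u (rotX u) = 2 * K * ε * ρ (qA u) * u 0 * u 1 := by
  simp only [dbelt, xdot_apply, ydot_apply, rotX_apply_zero, rotX_apply_one, rotX_apply_two, rotX_apply_three]
  ring

/-- **`DG(u) v₂ = τ χ₂(A) u₃ / √B`** (rotation of `y⃗`). [folklore] -/
theorem dbelt_rotY (u : 𝔼 4) : dbelt K ε k₁ τ ρ χ₂ u (rotY u) = τ * χ₂ (qA u) * u 3 * (Real.sqrt (qB u))⁻¹ := by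
  simp only [dbelt, xdot_apply, ydot_apply, rotY_apply0, rotY_apply1, rotY_apply2, rotY_apply3]
  ring

/-- **`DG(u) v₃ = 2A[K k₁ (A + B)] - 2 K ε u₀² (ρ(A) + A ρ'(A)) - 2 τ A χ₂'(A) u₂ / √B`**
(level-tangent radial vector; the angular terms are homogeneous of degree `0`). [folklore] -/
theorem dbelt_radV {u : 𝔼 4} (hB : qB u ≠ 0) :
    dbelt K ε k₁ τ ρ χ₂ u (radV u) =
      2 * K * k₁ * qA u * (qA u + qB u) - 2 * K * ε * u 0 ^ 2 * (ρ (qA u) + qA u * deriv ρ (qA u))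
        - 2 * τ * qA u * deriv χ₂ (qA u) * u 2 * (Real.sqrt (qB u))⁻¹ := by
  have hBpos : 0 < qB u := lt_of_le_of_ne (qB_nonneg u) (Ne.symm hB)
  have hs : Real.sqrt (qB u) ≠ 0 := Real.sqrt_ne_zero'.2 hBpos
  have hsq : Real.sqrt (qB u) ^ 2 = qB u := Real.sq_sqrt (qB_nonneg u)
  have hs3 : (Real.sqrt (qB u))⁻¹ ^ 3 = (qB u)⁻¹ * (Real.sqrt (qB u))⁻¹ := by
    conv_rhs => arg 1; rw [← hsq]
    rw [inv_pow]; ring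
  simp only [dbelt, xdot_apply, ydot_apply, radV_apply0, radV_apply1, radV_apply2, radV_apply3, hs3]
  set s := Real.sqrt (qB u) with hsdef
  have hA : qA u = u 0 ^ 2 + u 1 ^ 2 := rfl
  have hB' : qB u = u 2 ^ 2 + u 3 ^ 2 := rfl
  have hBne : u 2 ^ 2 + u 3 ^ 2 ≠ 0 := by rw [← hB']; exact hB
  rw [hA, hB']
  field_simp
  ring

/-! ### The critical points on the level -/

/-- At a point with `x⃗ = 0`, `u₃ = 0` (and `y⃗ ≠ 0`) the derivative of the belt function
vanishes identically. [folklore] -/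
theorem dbelt_eq_zero_of_coords {u : 𝔼 4} (h0 : u 0 = 0) (h1 : u 1 = 0) (h3 : u 3 = 0) (hB : qB u ≠ 0)
    (v : 𝔼 4) : dbelt K ε k₁ τ ρ χ₂ u v = 0 := by
  have hBpos : 0 < qB u := lt_of_le_of_ne (qB_nonneg u) (Ne.symm hB)
  have hs : Real.sqrt (qB u) ≠ 0 := Real.sqrt_ne_zero'.2 hBpos
  have hsq : Real.sqrt (qB u) ^ 2 = qB u := Real.sq_sqrt (qB_nonneg u)
  have hs3 : (Real.sqrt (qB u))⁻¹ ^ 3 = (qB u)⁻¹ * (Real.sqrt (qB u))⁻¹ := by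
    conv_rhs => arg 1; rw [← hsq]
    rw [inv_pow]; ring
  have hA : qA u = 0 := by rw [qA_apply, h0, h1]; ring
  have hB2 : qB u = u 2 ^ 2 := by rw [qB_apply, h3]; ring
  have hu2 : u 2 ≠ 0 := by
    intro h; apply hB; rw [hB2, h]; ring
  simp only [dbelt, xdot_apply, ydot_apply, hs3, hA, h0, h1, h3]
  set sr := Real.sqrt (qB u) with hsr
  rw [hB2]
  field_simp
  ring

/-- **Lagrange's condition on the level `{B - A = ν²}` singles out the two points
`(0, 0, ±ν, 0)`.**  Let `K, k₁, τ, ν > 0`, `ε ≥ 0`; let the profiles satisfy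
`0 ≤ ρ + Aρ' ≤ L` (`= (Aρ)'`), `|χ₂'| ≤ L₂`, `χ₂(0) ≠ 0`; and assume the smallness
`K ε L + τ L₂ < K k₁ ν²`.  Then at a point `u` of the level, `DG(u)` vanishes on the tangent
hyperplane `ker D(B - A)(u)` iff `u₀ = u₁ = u₃ = 0`.  (On the level-tangent radial vector
`DG = 2A[K k₁(A + B) - K ε (u₀²/A)(Aρ)' - τ χ₂' u₂/√B] ≥ 2A(K k₁ ν² - K ε L - τ L₂) > 0`
unless `A = 0`; then the rotation of `y⃗` gives `τ χ₂(0) u₃/√B = 0`.)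
[cite: GayKirby2016, §4, Lemma 14] [cite: Milnor1963, §2] -/
theorem critical_iff (hK : 0 < K) (hk : 0 < k₁) (hτ : 0 < τ) (hε : 0 ≤ ε) {L L₂ ν : ℝ} (hν : 0 < ν)
    (hρm : ∀ A, 0 ≤ ρ A + A * deriv ρ A) (hρL : ∀ A, ρ A + A * deriv ρ A ≤ L)
    (hχL : ∀ A, |deriv χ₂ A| ≤ L₂) (hχ0 : χ₂ 0 ≠ 0)
    (hsmall : K * ε * L + τ * L₂ < K * k₁ * ν ^ 2)
    {u : 𝔼 4} (hQ : qB u - qA u = ν ^ 2) :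
    (∀ v, 2 * ydot u v - 2 * xdot u v = 0 → dbelt K ε k₁ τ ρ χ₂ u v = 0) ↔
      (u 0 = 0 ∧ u 1 = 0 ∧ u 3 = 0) := by
  have hA0 := qA_nonneg u
  have hBeq : qB u = ν ^ 2 + qA u := by linarith
  have hBpos : 0 < qB u := by rw [hBeq]; positivity
  have hBne : qB u ≠ 0 := hBpos.ne'
  have hs : 0 < Real.sqrt (qB u) := Real.sqrt_pos.2 hBpos
  have hsq : Real.sqrt (qB u) ^ 2 = qB u := Real.sq_sqrt (qB_nonneg u)
  constructor
  · intro h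
    -- Step 1: `A = 0`
    have hA : qA u = 0 := by
      by_contra hAne
      have hApos : 0 < qA u := lt_of_le_of_ne hA0 (Ne.symm hAne)
      have h3 := h (radV u) (level_radV hBne)
      rw [dbelt_radV hBne] at h3
      -- bounds
      have hu0A : u 0 ^ 2 ≤ qA u := by rw [qA_apply]; nlinarith [sq_nonneg (u 1)]
      have hb1 : u 0 ^ 2 * (ρ (qA u) + qA u * deriv ρ (qA u)) ≤ qA u * L :=
        mul_le_mul hu0A (hρL _) (hρm _) hA0
      have hb1' : K * ε * (u 0 ^ 2 * (ρ (qA u) + qA u * deriv ρ (qA u))) ≤ K * ε * (qA u * L) :=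
        mul_le_mul_of_nonneg_left hb1 (by positivity)
      have hcos : |u 2 * (Real.sqrt (qB u))⁻¹| ≤ 1 := by
        rw [abs_mul, abs_inv, abs_of_pos hs]
        rw [← div_eq_mul_inv, div_le_one hs]
        have h2le : u 2 ^ 2 ≤ qB u := by rw [qB_apply]; nlinarith [sq_nonneg (u 3)]
        calc |u 2| = Real.sqrt (u 2 ^ 2) := (Real.sqrt_sq_eq_abs _).symm
          _ ≤ Real.sqrt (qB u) := Real.sqrt_le_sqrt h2le
      have hb2 : deriv χ₂ (qA u) * (u 2 * (Real.sqrt (qB u))⁻¹) ≤ L₂ := by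
        calc deriv χ₂ (qA u) * (u 2 * (Real.sqrt (qB u))⁻¹)
            ≤ |deriv χ₂ (qA u) * (u 2 * (Real.sqrt (qB u))⁻¹)| := le_abs_self _
          _ = |deriv χ₂ (qA u)| * |u 2 * (Real.sqrt (qB u))⁻¹| := abs_mul _ _
          _ ≤ L₂ * 1 := mul_le_mul (hχL (qA u)) hcos (abs_nonneg _) ((abs_nonneg _).trans (hχL (qA u)))
          _ = L₂ := mul_one _
      have hb2' : τ * qA u * (deriv χ₂ (qA u) * (u 2 * (Real.sqrt (qB u))⁻¹)) ≤ τ * qA u * L₂ :=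
        mul_le_mul_of_nonneg_left hb2 (by positivity)
      have hb3 : ν ^ 2 ≤ qA u + qB u := by rw [hBeq]; linarith
      have hb3' : K * k₁ * qA u * ν ^ 2 ≤ K * k₁ * qA u * (qA u + qB u) :=
        mul_le_mul_of_nonneg_left hb3 (by positivity)
      have hgap : 0 < qA u * (K * k₁ * ν ^ 2 - K * ε * L - τ * L₂) := mul_pos hApos (by linarith)
      have hexpr : 2 * K * k₁ * qA u * (qA u + qB u) - 2 * K * ε * u 0 ^ 2 * (ρ (qA u) + qA u * deriv ρ (qA u))
          - 2 * τ * qA u * deriv χ₂ (qA u) * u 2 * (Real.sqrt (qB u))⁻¹ ≥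
          2 * (qA u * (K * k₁ * ν ^ 2 - K * ε * L - τ * L₂)) := by nlinarith
      linarith
    obtain ⟨h0, h1⟩ := (qA_eq_zero_iff u).1 hA
    -- Step 2: `u₃ = 0`
    have h2 := h (rotY u) (level_rotY u)
    rw [dbelt_rotY, hA] at h2
    have hu3 : u 3 = 0 := by
      have hne : τ * χ₂ 0 * (Real.sqrt (qB u))⁻¹ ≠ 0 := by
        refine mul_ne_zero (mul_ne_zero hτ.ne' hχ0) (inv_ne_zero hs.ne')
      have h2' : (τ * χ₂ 0 * (Real.sqrt (qB u))⁻¹) * u 3 = 0 := by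
        calc (τ * χ₂ 0 * (Real.sqrt (qB u))⁻¹) * u 3 = τ * χ₂ 0 * u 3 * (Real.sqrt (qB u))⁻¹ := by ring
          _ = 0 := h2
      rcases mul_eq_zero.1 h2' with h' | h'
      · exact absurd h' hne
      · exact h'
    exact ⟨h0, h1, hu3⟩
  · rintro ⟨h0, h1, h3⟩ v _
    exact dbelt_eq_zero_of_coords h0 h1 h3 hBne v

/-- **The two points `(0, 0, ±ν, 0)` are critical points of the belt function on `ℝ⁴`.** [cite: GayKirby2016, §4, Lemma 14] -/
theorem fderiv_belt_eq_zero (hρ : Differentiable ℝ ρ) (hχ : Differentiable ℝ χ₂) {u : 𝔼 4}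
    (h0 : u 0 = 0) (h1 : u 1 = 0) (h3 : u 3 = 0) (hB : qB u ≠ 0) :
    fderiv ℝ (belt K ε k₁ τ ρ χ₂) u = 0 := by
  ext v
  rw [fderiv_belt_apply hρ hχ hB, dbelt_eq_zero_of_coords h0 h1 h3 hB v]
  rfl

/-! ### The Hessian at the two critical points -/

/-- The simplified belt function near a point with `x⃗ = 0`: `ρ(A) = 0`, `χ₂(A) = 1`. [folklore] -/
def beltS (K k₁ τ : ℝ) (w : 𝔼 4) : ℝ :=
  K * k₁ * (qA w * qB w) - τ * (w 2 * (Real.sqrt (qB w))⁻¹)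

/-- The partial derivatives of the simplified belt function (scalar functions). [folklore] -/
def dS0 (K k₁ : ℝ) (w : 𝔼 4) : ℝ := K * k₁ * (qB w * (2 * w 0))
/-- Second partial. [folklore] -/
def dS1 (K k₁ : ℝ) (w : 𝔼 4) : ℝ := K * k₁ * (qB w * (2 * w 1))
/-- Third partial. [folklore] -/
def dS2 (K k₁ τ : ℝ) (w : 𝔼 4) : ℝ :=
  K * k₁ * (qA w * (2 * w 2)) - τ * ((Real.sqrt (qB w))⁻¹ + w 2 * (-((Real.sqrt (qB w))⁻¹ ^ 3) * w 2))
/-- Fourth partial. [folklore] -/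
def dS3 (K k₁ τ : ℝ) (w : 𝔼 4) : ℝ :=
  K * k₁ * (qA w * (2 * w 3)) - τ * (w 2 * (-((Real.sqrt (qB w))⁻¹ ^ 3) * w 3))

/-- The derivative field of the simplified belt function: `DS(w) = Σᵢ ∂ᵢS(w) duᵢ`. [folklore] -/
def DS (K k₁ τ : ℝ) (w : 𝔼 4) : 𝔼 4 →L[ℝ] ℝ :=
  dS0 K k₁ w • P 0 + dS1 K k₁ w • P 1 + dS2 K k₁ τ w • P 2 + dS3 K k₁ τ w • P 3

/-- **The derivative of the simplified belt function** off `{y⃗ = 0}`. [folklore] -/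
theorem hasFDerivAt_beltS {w : 𝔼 4} (hB : qB w ≠ 0) : HasFDerivAt (beltS K k₁ τ) (DS K k₁ τ w) w := by
  have hA := hasFDerivAt_qA w
  have hBd := hasFDerivAt_qB w
  have h1 : HasFDerivAt (fun u => qA u * qB u) (qA w • ((2 * w 2) • P 2 + (2 * w 3) • P 3) +
      qB w • ((2 * w 0) • P 0 + (2 * w 1) • P 1)) w := hA.mul hBd
  have hinv := hasFDerivAt_sqrt_qB_inv hB
  have h3a : HasFDerivAt (fun u : 𝔼 4 => u 2 * (Real.sqrt (qB u))⁻¹)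
      (w 2 • ((-((Real.sqrt (qB w))⁻¹ ^ 3)) • ((2⁻¹ : ℝ) • ((2 * w 2) • P 2 + (2 * w 3) • P 3))) +
        (Real.sqrt (qB w))⁻¹ • P 2) w := (hasFDerivAt_coord 2 w).mul hinv
  have hall := (h1.const_mul (K * k₁)).sub (h3a.const_mul τ)
  have hall' : HasFDerivAt (beltS K k₁ τ) _ w :=
    hall.congr_of_eventuallyEq (Eventually.of_forall fun y => by simp only [beltS, Pi.sub_apply])
  refine hall'.congr_fderiv ?_
  ext v
  simp only [DS, dS0, dS1, dS2, dS3, sub_apply, add_apply, FunLike.coe_smul, Pi.smul_apply, P_apply,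
    smul_eq_mul]
  ring

/-- Near a point with `x⃗ = 0`, the belt function is the simplified one when `ρ = 0` and
`χ₂ = 1` near `A = 0`. [folklore] -/
theorem belt_eventuallyEq_beltS {r : ℝ} (hr : 0 < r) (hρ0 : ∀ A, A < r → ρ A = 0)
    (hχ1 : ∀ A, A < r → χ₂ A = 1) {u : 𝔼 4} (hA : qA u = 0) :
    belt K ε k₁ τ ρ χ₂ =ᶠ[𝓝 u] beltS K k₁ τ := by
  have hopen : IsOpen {w : 𝔼 4 | qA w < r} := isOpen_lt contDiff_qA.continuous continuous_const
  have hmem : u ∈ {w : 𝔼 4 | qA w < r} := by show qA u < r; rw [hA]; exact hr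
  filter_upwards [hopen.mem_nhds hmem] with w hw
  simp only [belt, beltS, hρ0 _ hw, hχ1 _ hw]
  ring

/-- Near a point with `y⃗ ≠ 0`, the derivative of the simplified belt function is `DS`. [folklore] -/
theorem fderiv_beltS_eventuallyEq {u : 𝔼 4} (hB : qB u ≠ 0) :
    fderiv ℝ (beltS K k₁ τ) =ᶠ[𝓝 u] DS K k₁ τ := by
  have hopen : IsOpen {w : 𝔼 4 | qB w ≠ 0} := isOpen_ne_fun contDiff_qB.continuous continuous_const
  filter_upwards [hopen.mem_nhds (show u ∈ {w : 𝔼 4 | qB w ≠ 0} from hB)] with w hw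
  exact (hasFDerivAt_beltS hw).fderiv

/-- **The derivative of the derivative field `DS` at a point with `x⃗ = 0`, `u₃ = 0`**:
`(D(DS)(u) v) w = 2 K k₁ u₂² (v₀w₀ + v₁w₁) + τ u₂ (√B)⁻³ v₃w₃`. [folklore] -/
theorem hasFDerivAt_DS {u : 𝔼 4} (h0 : u 0 = 0) (h1 : u 1 = 0) (h3 : u 3 = 0) (hB : qB u ≠ 0) :
    ∃ L : 𝔼 4 →L[ℝ] 𝔼 4 →L[ℝ] ℝ, HasFDerivAt (DS K k₁ τ) L u ∧
      ∀ v w, L v w = 2 * K * k₁ * u 2 ^ 2 * (v 0 * w 0 + v 1 * w 1)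
        + τ * u 2 * (Real.sqrt (qB u))⁻¹ ^ 3 * (v 3 * w 3) := by
  have hBpos : 0 < qB u := lt_of_le_of_ne (qB_nonneg u) (Ne.symm hB)
  have hs : Real.sqrt (qB u) ≠ 0 := Real.sqrt_ne_zero'.2 hBpos
  have hsq : Real.sqrt (qB u) ^ 2 = qB u := Real.sq_sqrt (qB_nonneg u)
  have hAd := hasFDerivAt_qA u
  have hBd := hasFDerivAt_qB u
  have hinv := hasFDerivAt_sqrt_qB_inv hB
  -- the inverse cube of `√B`
  have hinv3 : HasFDerivAt (fun w => (Real.sqrt (qB w))⁻¹ ^ 3)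
      ((3 * ((Real.sqrt (qB u))⁻¹) ^ 2) • ((-((Real.sqrt (qB u))⁻¹ ^ 3)) •
        ((2⁻¹ : ℝ) • ((2 * u 2) • P 2 + (2 * u 3) • P 3)))) u := by
    have := hinv.pow 3
    refine this.congr_fderiv ?_
    norm_num
  -- the four partials
  have hd0 : HasFDerivAt (dS0 K k₁) _ u :=
    ((hBd.mul ((hasFDerivAt_coord 0 u).const_mul 2)).const_mul (K * k₁)).congr_of_eventuallyEq
      (Eventually.of_forall fun y => by simp only [dS0, Pi.mul_apply])
  have hd1 : HasFDerivAt (dS1 K k₁) _ u :=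
    ((hBd.mul ((hasFDerivAt_coord 1 u).const_mul 2)).const_mul (K * k₁)).congr_of_eventuallyEq
      (Eventually.of_forall fun y => by simp only [dS1, Pi.mul_apply])
  have hc2 := hasFDerivAt_coord 2 u
  have hc3 := hasFDerivAt_coord 3 u
  have hprod2 : HasFDerivAt (fun w : 𝔼 4 => -((Real.sqrt (qB w))⁻¹ ^ 3) * w 2) _ u := hinv3.neg.mul hc2
  have hterm2 : HasFDerivAt (fun w : 𝔼 4 => w 2 * (-((Real.sqrt (qB w))⁻¹ ^ 3) * w 2)) _ u := hc2.mul hprod2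
  have hd2 : HasFDerivAt (dS2 K k₁ τ) _ u :=
    (((hAd.mul (hc2.const_mul 2)).const_mul (K * k₁)).sub ((hinv.add hterm2).const_mul τ)).congr_of_eventuallyEq
      (Eventually.of_forall fun y => by simp only [dS2, Pi.sub_apply, Pi.mul_apply, Pi.add_apply])
  have hprod3 : HasFDerivAt (fun w : 𝔼 4 => -((Real.sqrt (qB w))⁻¹ ^ 3) * w 3) _ u := hinv3.neg.mul hc3
  have hterm3 : HasFDerivAt (fun w : 𝔼 4 => w 2 * (-((Real.sqrt (qB w))⁻¹ ^ 3) * w 3)) _ u := hc2.mul hprod3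
  have hd3 : HasFDerivAt (dS3 K k₁ τ) _ u :=
    (((hAd.mul (hc3.const_mul 2)).const_mul (K * k₁)).sub (hterm3.const_mul τ)).congr_of_eventuallyEq
      (Eventually.of_forall fun y => by simp only [dS3, Pi.sub_apply, Pi.mul_apply])
  -- assemble `DS = Σ ∂ᵢ • Pᵢ`
  have hDS0 := ((hd0.smul_const (P 0)).add (hd1.smul_const (P 1))).add (hd2.smul_const (P 2)) |>.add
    (hd3.smul_const (P 3))
  have hDS : HasFDerivAt (DS K k₁ τ) _ u :=
    hDS0.congr_of_eventuallyEq (Eventually.of_forall fun y => by simp only [DS, Pi.add_apply])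
  refine ⟨_, hDS, fun v w => ?_⟩
  have hA : qA u = 0 := by rw [qA_apply, h0, h1]; ring
  have hB2 : qB u = u 2 ^ 2 := by rw [qB_apply, h3]; ring
  have hu2 : u 2 ≠ 0 := by intro h; apply hB; rw [hB2, h]; ring
  simp only [add_apply, sub_apply, neg_apply, ContinuousLinearMap.smulRight_apply, FunLike.coe_smul,
    Pi.smul_apply, Pi.neg_apply, P_apply, smul_eq_mul, h0, h1, h3, hA, hB2]
  rw [Real.sqrt_sq_eq_abs]
  rcases lt_or_gt_of_ne hu2 with hneg | hpos
  · rw [abs_of_neg hneg]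
    field_simp
    ring
  · rw [abs_of_pos hpos]
    field_simp
    ring

/-- **The Hessian of the belt function at `(0, 0, ±ν, 0)`**:
`D²G(u)(v, w) = 2 K k₁ u₂² (v₀w₀ + v₁w₁) + τ u₂ (√B)⁻³ v₃w₃` at a point `u` with
`u₀ = u₁ = u₃ = 0`, `u₂ ≠ 0`, when `ρ = 0` and `χ₂ = 1` near `A = 0`. [cite: GayKirby2016, §4, Lemma 14] [cite: Milnor1963, §2] -/
theorem fderiv_fderiv_belt_apply {r : ℝ} (hr : 0 < r) (hρ0 : ∀ A, A < r → ρ A = 0)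
    (hχ1 : ∀ A, A < r → χ₂ A = 1) {u : 𝔼 4} (h0 : u 0 = 0) (h1 : u 1 = 0) (h3 : u 3 = 0)
    (hB : qB u ≠ 0) (v w : 𝔼 4) :
    fderiv ℝ (fderiv ℝ (belt K ε k₁ τ ρ χ₂)) u v w =
      2 * K * k₁ * u 2 ^ 2 * (v 0 * w 0 + v 1 * w 1) + τ * u 2 * (Real.sqrt (qB u))⁻¹ ^ 3 * (v 3 * w 3) := by
  have hA : qA u = 0 := by rw [qA_apply, h0, h1]; ring
  have hev := belt_eventuallyEq_beltS (K := K) (ε := ε) (k₁ := k₁) (τ := τ) hr hρ0 hχ1 hA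
  rw [(hev.fderiv).fderiv_eq, (fderiv_beltS_eventuallyEq (K := K) (k₁ := k₁) (τ := τ) hB).fderiv_eq]
  obtain ⟨L, hL, hLvw⟩ := hasFDerivAt_DS (K := K) (k₁ := k₁) (τ := τ) h0 h1 h3 hB
  rw [hL.fderiv, hLvw]

/-- The belt function is `C^∞` at such a point and the two critical points are ambient
critical points — packaged for the dictionary of `BoundarySliceMorseLevel.lean`. [cite: GayKirby2016, §4, Lemma 14] -/
theorem contDiffAt_belt_of_coords (hρ : ContDiff ℝ ∞ ρ) (hχ : ContDiff ℝ ∞ χ₂) {u : 𝔼 4}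
    (hB : qB u ≠ 0) : ContDiffAt ℝ ∞ (belt K ε k₁ τ ρ χ₂) u :=
  contDiffAt_belt hρ hχ hB

/-! ### Signatures of the restricted Hessians on the tangent hyperplane `{v₂ = 0}` -/

section Restrict

open TubeModel (E4 E4_apply)

variable {Bf : LinearMap.BilinForm ℝ (𝔼 4)} {V : Submodule ℝ (𝔼 4)} {d c : ℝ}

/-- **Index `0` at `(0, 0, ν, 0)`**: a form `d (v₀w₀ + v₁w₁) + c v₃w₃` with `d, c > 0` is
positive definite on `V = {v₂ = 0}`, hence nondegenerate of negative index of inertia `0`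
there. [cite: GayKirby2016, §4, Lemma 14] [cite: Milnor1963, §2] -/
theorem nondegenerate_and_sigNeg_eq_zero_of_apply_eq (hd : 0 < d) (hc : 0 < c)
    (hBf : ∀ v w, Bf v w = d * (v 0 * w 0 + v 1 * w 1) + c * (v 3 * w 3))
    (hV : ∀ v, v ∈ V ↔ v 2 = 0) :
    (Bf.restrict V).Nondegenerate ∧ sigNeg (Bf.restrict V).toQuadraticMap = 0 := by
  have hpd : (Bf.restrict V).toQuadraticMap.PosDef := by
    intro x hx
    have hx2 : (x : 𝔼 4) 2 = 0 := (hV _).1 x.2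
    have hne : (x : 𝔼 4) 0 ≠ 0 ∨ (x : 𝔼 4) 1 ≠ 0 ∨ (x : 𝔼 4) 3 ≠ 0 := by
      by_contra h
      simp only [not_or, not_not] at h
      apply hx
      refine Subtype.ext ?_
      ext i
      fin_cases i
      · simpa using h.1
      · simpa using h.2.1
      · simpa using hx2
      · simpa using h.2.2
    simp only [LinearMap.BilinMap.toQuadraticMap_apply, LinearMap.BilinForm.restrict_apply,
      LinearMap.domRestrict_apply, hBf]
    rcases hne with h | h | h
    · have := sq_pos_of_ne_zero h
      nlinarith [sq_nonneg ((x : 𝔼 4) 1), sq_nonneg ((x : 𝔼 4) 3), mul_pos hd this]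
    · have := sq_pos_of_ne_zero h
      nlinarith [sq_nonneg ((x : 𝔼 4) 0), sq_nonneg ((x : 𝔼 4) 3), mul_pos hd this]
    · have := sq_pos_of_ne_zero h
      nlinarith [sq_nonneg ((x : 𝔼 4) 0), sq_nonneg ((x : 𝔼 4) 1), mul_pos hc this]
  refine ⟨⟨fun x hx => ?_, fun x hx => ?_⟩, LinearMap.BilinForm.sigNeg_eq_zero_of_posDef hpd⟩
  · by_contra h0
    have := hpd x h0
    simp only [LinearMap.BilinMap.toQuadraticMap_apply, hx x] at this
    exact lt_irrefl _ this
  · by_contra h0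
    have := hpd x h0
    simp only [LinearMap.BilinMap.toQuadraticMap_apply, hx x] at this
    exact lt_irrefl _ this

/-- **Index `1` at `(0, 0, -ν, 0)`**: a form `d (v₀w₀ + v₁w₁) + c v₃w₃` with `d > 0 > c`
restricted to `V = {v₂ = 0}` is nondegenerate of negative index of inertia `1` (the negative
line `ℝ e₃` splits off a positive definite plane). [cite: GayKirby2016, §4, Lemma 14] [cite: Milnor1963, §2] -/
theorem nondegenerate_and_sigNeg_eq_one_of_apply_eq (hd : 0 < d) (hc : c < 0)
    (hBf : ∀ v w, Bf v w = d * (v 0 * w 0 + v 1 * w 1) + c * (v 3 * w 3))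
    (hV : ∀ v, v ∈ V ↔ v 2 = 0) :
    (Bf.restrict V).Nondegenerate ∧ sigNeg (Bf.restrict V).toQuadraticMap = 1 := by
  have hE0 : E4 0 ∈ V := (hV _).2 (by simp)
  have hE1 : E4 1 ∈ V := (hV _).2 (by simp)
  have hE3 : E4 3 ∈ V := (hV _).2 (by simp)
  have hsep : ∀ x : V, (∀ y : V, Bf x y = 0) → x = 0 := by
    intro x hx
    have hx2 : (x : 𝔼 4) 2 = 0 := (hV _).1 x.2
    have h0 := hx ⟨E4 0, hE0⟩
    have h1 := hx ⟨E4 1, hE1⟩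
    have h3 := hx ⟨E4 3, hE3⟩
    simp only [hBf, E4_apply] at h0 h1 h3
    simp only [Fin.isValue, ↓reduceIte, mul_one, Fin.reduceEq, mul_zero, add_zero, zero_add,
      mul_eq_zero, hd.ne', hc.ne, false_or] at h0 h1 h3
    refine Subtype.ext ?_
    ext i
    fin_cases i
    · simpa using h0
    · simpa using h1
    · simpa using hx2
    · simpa using h3
  have hsymm : ∀ x y : V, Bf x y = Bf y x := fun x y => by rw [hBf, hBf]; ring
  refine ⟨⟨fun x hx => hsep x (fun y => by simpa using hx y),
    fun x hx => hsep x (fun y => by rw [hsymm]; simpa using hx y)⟩, ?_⟩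
  -- the index: project to the `v₃`-line
  let π : V →ₗ[ℝ] ℝ := ((EuclideanSpace.proj (3 : Fin 4) : 𝔼 4 →L[ℝ] ℝ).toLinearMap).comp V.subtype
  let ι : ℝ →ₗ[ℝ] V := LinearMap.codRestrict V (LinearMap.toSpanSingleton ℝ (𝔼 4) (E4 3))
    (fun t => V.smul_mem t hE3)
  let Q' : QuadraticForm ℝ ℝ :=
    LinearMap.BilinMap.toQuadraticMap (c • (LinearMap.mul ℝ ℝ : ℝ →ₗ[ℝ] ℝ →ₗ[ℝ] ℝ))
  have hQ' : ∀ t : ℝ, Q' t = c * (t * t) := fun t => by simp [Q']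
  have hQ : ∀ x : V, (Bf.restrict V).toQuadraticMap x =
      d * ((x : 𝔼 4) 0 * (x : 𝔼 4) 0 + (x : 𝔼 4) 1 * (x : 𝔼 4) 1) + c * ((x : 𝔼 4) 3 * (x : 𝔼 4) 3) :=
    fun x => by simp [LinearMap.BilinMap.toQuadraticMap_apply, hBf]
  have key : sigNeg (Bf.restrict V).toQuadraticMap = sigNeg Q' := by
    refine sigNeg_eq_of_proj _ Q' π ι (fun x => ?_) (fun x hx => ?_) (fun t => ?_) (fun t => ?_)
    · rw [hQ, hQ']
      simp only [π, LinearMap.coe_comp, Submodule.coe_subtype, comp_apply, ContinuousLinearMap.coe_coe]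
      show c * (((x : 𝔼 4)) 3 * ((x : 𝔼 4)) 3) ≤ _
      nlinarith [sq_nonneg ((x : 𝔼 4) 0), sq_nonneg ((x : 𝔼 4) 1)]
    · simp only [π, LinearMap.coe_comp, Submodule.coe_subtype, comp_apply, ContinuousLinearMap.coe_coe] at hx
      have hx3 : (x : 𝔼 4) 3 = 0 := hx
      rw [hQ, hx3]
      nlinarith [sq_nonneg ((x : 𝔼 4) 0), sq_nonneg ((x : 𝔼 4) 1)]
    · rw [hQ, hQ']
      simp [ι]
    · simp [π, ι]
  rw [key]
  apply le_antisymm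
  · calc sigNeg Q' = sigPos (-Q') := by rw [sigPos_neg]
      _ ≤ Module.finrank ℝ ℝ := sigPos_le_finrank _
      _ = 1 := Module.finrank_self ℝ
  · have hneg : ((-Q').restrict ⊤).PosDef := by
      intro t ht
      have ht' : (t : ℝ) ≠ 0 := fun h => ht (Subtype.ext h)
      simp only [QuadraticMap.restrict_apply, QuadraticMap.neg_apply, hQ']
      nlinarith [mul_pos (neg_pos.2 hc) (mul_self_pos.2 ht')]
    have := le_sigNeg_of_negDef Q' hneg
    rw [finrank_top, Module.finrank_self] at this
    exact this

end Restrict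


end BeltModel

end Literature.Topology.FourManifolds

end
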